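import Summits.NavierStokesRegularity.NavierStokesRegularity.Theses.PerpetualPump
import Literature.Analysis.FluidPDE.TaoCascadeDuhamel

/-!
# Disproof of `PumpTransfer` (crux stmt-NavierStokesRegularity-1837, route PerpetualPump) — findings

Standing adversary file (refuter-cdisprove-stmt-NavierStokesRegularity-1837). Prose lives in
docstrings; everything outside `-- Near-misses` is sorry-free.

`PumpTransfer := CircuitPump → AveragedTypeIBlowup` (both inlined; `pumpTransfer_iff`, `Iff.rfl`).

## Findings (cycle 1, v8, 2026-08-16)

1. **Thesis-hardness of any kill** (`not_pumpTransfer_iff`): `¬ PumpTransfer ↔ CircuitPump ∧ Thesis`,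
   because `AveragedTypeIBlowup ↔ ¬ Thesis` (`averagedTypeIBlowup_iff_not_thesis`). An UNCONDITIONAL
   refutation of this crux therefore (a) proves the route's rank-0 target `Thesis` (abstract Type-I
   exclusion over Tao's averaging class = the open question of Tao2016AveragedNS §1.1 p.8 footnote at
   the `L^∞`-rate tier) and (b) constructs the dyadic perpetual pump (crux #2, stmt-1834). No cheap
   kill exists; the crux "resists" for a structural reason, not for lack of attacks.
2. **Two cheap PROOF routes exist and both bypass the transfer** (`pumpTransfer_of_not_circuitPump`,
   `pumpTransfer_of_averagedTypeIBlowup`): an ODE abstract-Liouville theorem `¬ CircuitPump` closes the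
   item vacuously; a direct PDE pump closes it by weakening. Provers: a proof of this item that does
   not mention Tao's Thm 3.2 embedding is one of these two and says nothing about transfer.
3. **Load-bearing hypotheses of the antecedent** (§3). For an implication crux the informative
   mutation is: which conjuncts of the inlined `CircuitPump` keep the antecedent from being
   TRIVIALLY satisfiable? Dropping the ODE (`antecedentWithoutODE_holds`, witness
   `X_n(t) = lam^{-3n/5}/√(-t)`), the Type-I bound (`antecedentWithoutTypeI_holds`, witness: free heat
   modes `X_n(t) = lam^{-n/5} e^{-lam^{4n/5} t}`, `m = 1`, `coeff = 0`) or non-triviality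
   (`antecedentWithoutNontrivial_holds`, witness `X = 0`) makes the antecedent TRUE by an explicit
   closed form, and then the mutated crux is LITERALLY `¬ Thesis`
   (`pumpTransferWithoutODE_iff_not_thesis`, `…WithoutTypeI…`, `…WithoutNontrivial…`): the crux is
   one antecedent-conjunct away from being the route-killer itself. Consequently no
   `_false_without_<H>` theorem can be landed for ANY hypothesis `H` without proving `Thesis`.
4. **Small models of the antecedent** (§2, §3b): `m = 0` admits no witness (`no_witness_m0`);
   zero structure constants admit no witness for ANY `lam > 0`, `m`, `k` (`no_witness_zero_coeff`,
   via the free-mode lemma `free_mode_vanishes`: `X' = -dX` with a Type-I bound forces `X ≡ 0`), so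
   every witness has `coeff ≠ 0` (`coeff_ne_zero_of_witness`); at `m = 1` Tao's symmetry (4.2) +
   cyclic cancellation force `coeff none = 0`, `coeff (some 0) = coeff (some 1) =: a`,
   `coeff (some 2) = -2a` (`m1_coeff_classification`), i.e. the `m = 1` circuit class IS the
   Katz–Pavlović / Cheskidov dyadic model `Ẋ_n = -lam^{4n/5} X_n + 2a (lam^n X_n X_{n+1} - lam^{n-1} X_{n-1}^2)`
   at intermittency `α = 2/5` — as Tao says himself (arXiv:1402.0290 p. 23: "the viscous equation
   generalises the dyadic Katz-Pavlovic equation (with `λ = (1+ε₀)^{5/2}` and `α = 2/5`), which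
   corresponds to a simple case in which `m = 1`"). For non-negative finite-energy data that model
   is globally regular at BMR's `λ` (BarbatoMorandinRomito2011 Thm 1; tree barrier
   `Literature.Barriers.NavierStokesRegularity.DyadicCascadeRegularity`, whose audit notes the
   `λ`-sensitivity), and heuristically for every `λ`: the inviscid KP front leaks a fixed energy
   fraction per step (anomalous Dombre–Gilson exponent), more than the `1 - lam^{-2/5} → 0` that a
   critical DSS orbit may lose as `lam → 1`; so an `m = 1` pump, if any, is signed and in any case
   useless for THIS crux, which needs `lam ≤ (1+10⁻¹⁰)^{5/2}` (Thm 3.2) and hence a circuit passing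
   all but `O(10⁻¹⁰)` of the front energy per step (Tao's `m = 4` delayed-abrupt-transfer design,
   residual `K^{-20}`).
5. **What a transfer proof must really show** (analysis, no Lean content; for the provers). For a
   local cascade operator `C` (Tao Def 3.1) the cascade PDE `∂ₜu = Δu + C(u,u)` is EXACTLY — not
   approximately — the circuit ODE in which every scalar mode `X_{i,n}` is replaced by the heat flow on
   the Fourier ball `B_{i,n}`: `C(u,u)` takes values in `span ψ_{i,n}` and sees `u` only through
   `X_{i,n} = ⟨u, ψ_{i,n}⟩`, while `Δ` acts on `B_{i,n}` with symbol `-4π²|ξ|² = -4π² N_n² (1+θ)`,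
   `θ ∈ [0, 3ε₀]`. Hence `X_{i,n}(t) = (free part) + ∫ K_{i,n}(t-s) N_{i,n}(X(s)) ds` with the
   completely monotone kernel `K_{i,n}(τ) = ∫ |ψ̂_{i,n}|² e^{-4π²|ξ|²τ} dξ`, a mixture of
   exponentials with rates in `4π²N_n²[1, 1+3ε₀]` (Lemma 4.1 (iii)-(iv) is the statement that this
   mixture is `O(ε₀)`-close to a pure exponential). The mixed system is still AUTONOMOUS and EXACTLY
   invariant under Tao's scaling `(n,t,X) ↦ (n+1, lam^{-4/5}t, lam^{-1/5}X)` when `ψ_{i,n}` are the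
   `L²`-rescalings of fixed `ψ_i`. So `PumpTransfer` (for data built this way) is precisely:
   *the DSS Type-I relative periodic orbit of the sharp-rate circuit persists, together with a
   codimension-one stable set reachable from Schwartz data supported on scales `≥ n₀`, when each
   mode's damping rate is smeared by an absolutely continuous law of width `O(ε₀)` (the law
   `|ψ̂_i|²`-pushforward of `|ξ|²/N² - 1`, at our disposal but never a Dirac mass).* Every mode lives at
   most `O(1)` of its own dissipation times before the blow-up time (frozen trail), so sub-mode
   dephasing is `O(ε₀)` uniformly: the perturbation is genuinely small in `C⁰`; what is missing is
   `C¹` control = hyperbolicity of the orbit modulo the two symmetry directions (time translation,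
   and the amplitude direction which is ALLOWED to be unstable: it is the shooting parameter `A` of
   the datum `A ψ_{1,n₀}`, cf. Cruxes/CircuitPump/TRIAGE-r1-1.md: multipliers `lam^{4/5}` (gauge) and
   `lam^{1/5}` (amplitude)). A pump that is non-hyperbolic beyond these (e.g. a chaotic edge state,
   or a continuous family) would make `CircuitPump` true and the transfer unfounded — that is the
   only scenario in which this crux is false, and it cannot be exhibited without first settling
   crux #2.
6. **Conclusion-side junk audit**: none found. The zero datum/solution never witnesses
   `AveragedTypeIBlowup` (`zero_solution_extends`: `u ≡ 0` extends to every `[0,T')`); the Duhamel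
   time integral in `IsMildSolutionFor` is a Bochner integral but its integrand is continuous on
   `[0,t]` for `t < T` (no junk inside the lifespan); an extension `v` on `Ico 0 T'` must be
   `H¹⁰`-continuous AT `T`, so "no extension" is exactly `H¹⁰` blow-up of the unique mild solution —
   honest. `ENNReal.ofReal (M/√(T-t))` with `M < 0` forces `u = 0` (harmless). The ODE sup-Type-I
   hypothesis is weaker than summability in `n`, but for a DSS profile `f` bounded near `τ → 0` the
   profile equation `τ f' = f/2 + τ f - √τ Q` forces `f → 0`, so the PDE `L^∞` rate
   `‖u(t)‖_∞ ≲ Σ_n lam^{3n/5}|X_n| ≲ (T-t)^{-1/2}` is consistent (trail `g₀ lam^{2n/5}` geometric below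
   the front, super-exponential above).
7. **Regime bookkeeping at fine `lam` (heuristic, for the provers; numbers from
   Cruxes/CircuitPump/TRIAGE-r1-1.md and its budget identity; CORRECTED in v3 using the `δ`-dial of
   Cruxes/AveragedTypeIBlowup/Ideas/exact-volterra-embedding.md, ideator 3 on crux #3, which found
   the reformulation of finding 5 independently).** With `lam = (1+ε₀)^{5/2}` a DSS Type-I orbit
   may lose per step only the energy fraction `1 - lam^{-2/5} ≈ ε₀` (dissipation + residual trail);
   for Tao's gate this pins the critical amplitude (critical units `A = lam^{n/5}|X|` = nonlinear
   rate / dissipation rate) at `A* = √2 lam^{1/5}/(lam^{1/5}-1) ≈ 2√2/ε₀` (`≈ 3·10¹⁰` at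
   `ε₀ = 10⁻¹⁰`): the pump is an almost inviscid front; each mode is active for `~ε₀` of its own
   dissipation time and then frozen for `O(1)` dissipation times before `T`. In the SECTION
   (renormalised return-map) formulation the pump is a fixed point with ONE symmetry-forced unstable
   multiplier `lam^{1/5} ≈ 1 + ε₀/2` (amplitude = the shooting parameter) and "shape" multipliers
   set by the fast internal gate dynamics (can be `O(1)`-hyperbolic; nothing forces it). The
   smearing of finding 5 has relative width `δ` = thickness of the spectral shell on which `|ψ̂_i|²`
   concentrates inside its ball — a design dial INDEPENDENT of `ε₀` (all balls `B_i` may be centred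
   on one sphere `|ξ| = r₀`, and `|ψ̂_i|²` concentrated within relative distance `δ` of it; `r₀²`
   only renormalises the dissipation constant). Its effect on the step map is `O(δ·ε₀)` in `C⁰`
   during the active phase (rate detuning `δ` acting for `ε₀` dissipation times) and `O(δ)`·(trail
   forcing `≲ ε₀`) afterwards — `O(δ ε₀)` against an amplitude gap `ε₀/2` and shape gaps `g`:
   perturbative as soon as `C(K,ε)·δ ≪ min(1, g)`, with NO constraint tying `δ` to `ε₀`. So the
   v2 worry "`O(ε₀²)` against `ε₀/2`, constants matter" dissolves: the only genuinely missing
   inputs of a transfer proof are (a) `C¹`-regularity of the section map of the exact fading-memory system in `δ` (Hale-type persistence for Volterra/Prony extensions) and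
   (b) HYPERBOLICITY OF THE SHAPE DYNAMICS of the chosen pump — which crux #2 as stated (bare
   existence, currently pursued by `C⁰` covering/degree lines) does not supply. Disprover's
   recommendation (not filed; planner's call): strengthen the antecedent of this crux to "a pump
   whose renormalised section map is `C¹` near the fixed point with no multiplier on the unit
   circle and exactly one outside (`≈ lam^{1/5}`)"; with that antecedent the crux is a regular
   perturbation statement, without it the crux can fail only through a degenerate pump, which
   cannot be exhibited before crux #2 is settled.

8. **On the nine idea cards filed for this crux (2026-08-16 00:53–01:21Z; read: window-crossing-pump,
   energy-budget-threshold, threshold-pinch, exact-volterra-embedding on #3; skimmed titles of the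
   rest).** Adversarial notes for triagers/lead, no grades: (i) LOGICAL POSITION — the threshold /
   connectedness / window-crossing lines prove `AveragedTypeIBlowup` DIRECTLY (their transfer is
   `fun _ => h`, cheap route 2 of finding 2): they attack crux #3 = `¬ Thesis`, i.e. the ROUTE TARGET's
   negation, not an ODE⇒PDE transfer; fine, but then their difficulty is exactly that of #3 and the
   verdict of Cruxes/AveragedTypeIBlowup/Disproof.lean (sandwich NS-Type-I ⇒ #3 ⇔ ¬Thesis) applies.
   (ii) THEIR COMMON LOAD-BEARING NEW CLAIM is a global statement about Tao's circuit from UNPREPARED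
   configurations — "NoQuietTypeII" / "restart": *any* checkpoint state of the (exact, lifted) cascade
   with large critical amplitude ignites Tao's robust Type-II mechanism. Tao's Prop. 6.3 does not give
   this: its induction takes the prepared configuration (viii)–(ix) AND the spin conditions
   (spin-1)–(spin-2a) on the rotor of scale `n-1` as hypotheses at every checkpoint (p. 32: needed
   "to ensure that the rotor at scale n−1 is rotating so quickly that the modes at scale n−1 do not
   cause any constructive interference"); a threshold trajectory is by definition where slack runs
   out, so "large amplitude ⇒ hypotheses of 6.3 with slack" must be proved for configurations with
   leftover energy in `X_{2,3,4}`, adversarial rotor phases and an `O(ε₀)`-fed trail — a theorem about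
   the circuit, not a citation. Cheapest falsifier: a kit run of the (caricature) circuit from randomised
   large-amplitude checkpoint states, recording whether the critical amplitude of the NEXT checkpoint
   exceeds the current one (robust ignition) for all of them. (iii) "Small critical data decay" (S) and
   the energy-budget bound on dwell times look RIGHT (ℓ^∞-in-scale comparison; for the lifted Volterra
   system the kernel is completely monotone, so the comparison survives); the Type-I RATE from "bounded
   critical norm + dwell bound" is correct bookkeeping PROVIDED the trail stays subcritical (true for
   Tao's `K^{-20}` residuals). (iv) The topological selection (IVT / Ważewski window) gives EXISTENCE of a
   threshold datum cheaply; everything difficult is in the classification of the threshold dynamics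
   ("blow-up, and at Type-I rate"), where (ii) is the crux. (v) None of this is refutable by this seat
   without simulating Tao's stiff circuit; j009150 (below) probes the caricature.

9. **NUMERICS (kit j017138, `toy/pump_edge.py` v2c, 2026-08-16; 179 s wall) — a DSS Type-I EDGE STATE of an
   autonomous viscous m = 4 Tao-type circuit at α = 2/5 EXISTS, is reached from a RAY datum by drift-sign
   shooting, is structurally stable under the exact heat-fibre smearing of finding 5, BUT large amplitude alone
   does NOT ignite unprepared configurations.** Caricature of Tao (6.2)–(6.5) (rotor `p = ε⁻²`, slow pump
   `q = ε`, amplifier `r = G/ε`, seed `s`; `(ε,G,s,K) = (0.1, 10, 10⁻³, 4)`; coupling `lam^n`, damping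
   `lam^{4n/5}`, `lam = 2`, `N = 20` scales, datum `A·e_{a,0}`), classification of a trajectory by the
   least-squares drift of `log A_n`, `A_n := lam^{n/5}√(2 max_t E_n)` (critical amplitude = nonlinear rate /
   damping rate of scale `n`), bisection on its sign:
   * SHARP ODE (J = 1): threshold `A* = 24.79858…`; ON the threshold the critical amplitudes are CONSTANT,
     `A_n = 24.3473` for `n = 1,…,15` (rel. std `5·10⁻⁸`), hop-time ratios `τ_{n+1}/τ_n = 0.5743 = lam^{-4/5}`
     (`0.57435`) for `n = 2,…,13`, residual energy left per scale `13.2 %` (constant): an exact-looking `k = 1`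
     discretely self-similar Type-I orbit (`‖u‖_∞ ∝ A*·(T−t)^{-1/2}`), attracting from the very first scale
     (the "shape" directions contract in ONE step: strong hyperbolicity in this family), repelling only in
     amplitude (off-threshold drift `±` a few `%`/scale, `lam^{1/5}√(1−ℓ)` law). Budget check: allowed loss
     `1 − lam^{-2/5} = 24.2 %` = residual `13.2 %` + dissipation `≈ 9–11 %` ⇒ `2t_c/A* ≈ 0.1`, `t_c ≈ 1.2` ✓.
   * SMEARED (each mode = J = 3 heat fibres with rates spread uniformly over `[1, 1+δ]·lam^{4n/5}`,
     nonlinearity through the fibre mean — the exact structure of Lemma 4.1's lift): `δ = 0.02, 0.05, 0.2`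
     give `A* = 25.0466, 25.4184, 27.2767`, plateaux `24.5908, 24.9558, 26.7803`, the SAME hop ratio
     `0.57433` and residual `13.2 %`. The plateau shift is the trivial MEAN-rate renormalisation
     `24.3473·(1+δ/2) = 24.5908, 24.9560, 26.7820` to `< 10⁻⁴` relative even at `δ = 0.2`: after mean
     matching the edge state is unchanged to four digits — first order cancels, as predicted
     (`∫(σ−σ̄)dμ = 0`; cards spectral-lift / rho-inclusion / spectral-law-continuation; their toys j007898,
     j008349 found the same `δ²` law). This is the transfer question of THIS crux answered numerically for
     the caricature: the smearing is harmless given the (here manifest) hyperbolicity — finding 7.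
   * RESTART PROBE (lead's Q2, finding 8 (ii)): from the near-threshold trajectory's state when the front
     reaches scale 6, mix the four mode means at the two leading scales by a random orthogonal matrix
     (energy-preserving "unprepared configuration"), optionally multiply all leading modes by `2.5`, run 8
     scales: amplitude ×1 — ALL 8 samples decay (drifts `−0.05 … −0.26`/scale); amplitude ×2.5 (6× the
     threshold ENERGY) — only 3/8 ignite (drift `+0.03`), 5/8 DECAY (drifts `−0.03 … −0.14`; e.g.
     `A_n = 57 → 19 → 7.9 → … → 1.2`). Mechanism: energy rotated into the slow channel (`b` feeds back to `a`
     only at rate `q·a = ε·a`) or into a de-amplifying sign (`b < 0` makes `ċ = r b c` a decay) idles for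
     `~1/(εa)` local times while damping acts, and the next scale receives its energy piecemeal. So
     **"large critical amplitude at a checkpoint ⇒ robust (Tao) ignition" is FALSE for arbitrary
     configurations** already in the caricature; in Tao's hierarchy (`q = ε` smaller, `r = K^{10}/ε` larger)
     parking energy in `X_{2,3}` is even more lethal. CONSEQUENCE FOR `stub_rayTypeI` / lemma (R): the restart
     lemma must carry a CONFIGURATION HYPOTHESIS (a "prepared cone": energy share of `X_{1,n}`, signs/sizes
     of `X_{2,3,4,n}`, trail bounds — Tao's (viii)–(ix)+(spin) are one such cone) AND the threshold argument
     must prove that near-threshold trajectories from ray data STAY in that cone at every checkpoint (an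
     invariance statement with zero slack at threshold) — not merely that the amplitude stays large. The
     unmixed threshold trajectory itself does stay prepared here (it sits on the plateau), so the cone
     statement is plausible; it is the part of (R) that no card has written down.
   * CONE WIDTH and FINE-RATIO FOLLOW-UP (kit j017300, v2d, 161 s): mixing by a rotation of angle `θ` in a
     random 2-plane of the four mode means at the two leading scales of the threshold checkpoint, 4 samples
     each: `θ = 0.1` — amplitude ×1: drifts `+0.002…+0.007` (all cross to the ignition side), ×2.5: all ignite
     (`+0.032…+0.035`); `θ = 0.3` — ×1: `−0.016, −1.5·10⁻⁵, −0.006, −0.124`, ×2.5: `−0.037, +0.031, +0.023,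
     +0.029` (3/4); `θ = 1.0` — ×1: all decay (`−0.05…−0.17`), ×2.5: `−0.20, +0.029, −0.006, +0.016` (2/4).
     So the "prepared cone" inside which large amplitude guarantees ignition has an angular width of order
     `0.1–0.3 rad` in the leading-scale mode means (for this circuit); outside it, 6× threshold energy is not
     enough. And at the FINER ratio `lam = 1.5` the same circuit has NO blow-up side at all up to A = 1024:
     `A = 64` gives `A_n = 64, 55.4, 48.6, 42.4, …, 4.1` (drift `−0.21`/scale) — the per-scale factor
     `lam^{1/5}√(1−ℓ) = 1.084·√(1−ℓ)` is `< 1` as soon as the loss `ℓ` exceeds `1 − lam^{-2/5} = 15 %`, and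
     this circuit's INVISCID leak alone is `≈ 13 %` residual + drain inefficiency: numerically confirming
     the budget-identity necessary condition of findings 4/7 (a pump at fine `lam` needs inviscid leak
     `≲ (2/5) log lam`; amplitude cannot compensate an inviscid leak). For THIS crux (Thm 3.2 needs
     `lam ≤ (1+10⁻¹⁰)^{5/2}`) every witness circuit must therefore be Tao-efficient (residual `≲ 10⁻¹⁰`),
     i.e. live deep in the `(K, ε)` hierarchy where none of these caricature numerics apply directly.
   Caveats: caricature constants (leaky: 13 % residual/scale vs Tao's `K^{-20}`), `lam = 2` not fine,
   random orthogonal mixing is a violent notion of "unprepared"; numerics at rtol `10⁻⁸` (BDF, block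
   tridiagonal sparsity), drift-sign bisection to `2⁻²²`. Script, logs and `summary.json`:
   `~/compute/j017138/`, `~/compute/j017300/` (evidence `compute-j017138.json`, `compute-j017300.json` on the item).

## Computations (kit)
* j009150 (submitted 2026-08-16, pending): `toy/pump_smear.py` — transfer toy. Viscous Tao-type
  4-mode chain ((6.2)–(6.5) structure, moderate constants, `lam = 2`, `N = 12` scales): bisection on
  the datum amplitude for the threshold ("edge") trajectory = numerical shadow of the DSS pump, then
  the SAME with every mode replaced by `J = 5` sub-modes whose damping rates are spread over
  `[0, 3δ]`, `δ ∈ {0.02, 0.1, 0.4}` (the script calls the dial `eps0`; it is the shell-thickness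
  dial `δ` of finding 7 — the exact effect of Lemma 4.1's inexact diagonalisation, finding 5). Reading key: persistence ⇔ `A*(ε₀)` and the plateau of critical amplitudes
  `A_n = lam^{n/5}√(2 max_t E_n)` move continuously with `ε₀` and the step-time ratio stays
  `≈ lam^{-4/5}`; destruction ⇔ plateau rel.std jumps / no bracket. RESULT (2026-08-16T05:47Z):
  TIMED OUT at the cdisprove 0.5 h clamp (rc 124) after phase 1 + the sharp-ODE bisection. Phase 1
  (inviscid, 16 constant sets): the caricature gates are LEAKY (mean residual 0.17–0.77 of peak energy per
  scale); best set (ε,G,seed,K) = (0.1,10,10⁻³,4) has an inviscidly SUPER-critical front (A_n ×1.05/scale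
  against the ×1.149 = lam^{1/5} of lossless transfer ⇒ 83 % of peak energy forwarded), so a viscous
  threshold can exist (allowed DSS loss 1−lam^{-2/5} = 24 %). Phase 2 (ν=1, J=1, N=12): the argmax-front +
  "stall" classifier was DEFEATED by the large residuals and the chain top (super-critical runs with A_n
  growing 3 %/scale were classified "stall" at scales 8–9; the bisection converged to A ≈ 78.10, an artefact,
  NOT an edge: A_n drifts monotonically through it). Usable reading: drift of log A_n is −1.5 %/scale at
  A = 20 and +2…3.5 %/scale at A = 63…78, so the drift-sign threshold of this circuit lies in (20, 63).
  Smeared runs (J=5): 3 trajectories only, 150–470 s each (dense 240-variable BDF restarts) — inconclusive.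
* j016624 (submitted 2026-08-16T10:5xZ, `--tag long`, 1 h): `toy/pump_edge.py` v2 — drift-sign bisection
  (least-squares slope of log A_n over completed late scales), N = 22, block-tridiagonal `jac_sparsity` BDF,
  activation-based front; tasks in parallel: J=1 sharp (+ the lead's Q2 probe: restart from the near-threshold
  checkpoint at scale 6 with random orthogonal mixing of (a,b,c,d) at the two leading scales, amplitude ×1 and
  ×2.5, 8 samples each — robust ignition ⇔ all drifts > 0), J=3 smeared δ ∈ {0.05, 0.2} (N = 20), and J=1 at
  lam = 4 (N = 14). Reading key in the script header. RESULT: j016624 killed for MEMORY (4.3 GB: unbounded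
  dense output in stiff windows; the lam = 4 task was too stiff in absolute time) — but its log already showed
  the smeared δ = 0.2 plateau `A_n = 26.89 … 27.00` at A = 27.39; j016883 (v2b, t_eval sampling) CANCELLED by this
  seat (a fixed 90 s window guard killed every super-critical run whose first window contained a whole
  multi-scale runaway); j017138 (v2c: window = 1/20 of min(damping, nonlinear) time at the front; J=1 + probe,
  J=3 δ ∈ {0.02,0.05,0.2}; N = 20; 22 bisection steps) — DONE rc 0 in 179 s: finding 9.
* j017300 (v2d, 161 s): small-angle cone probe θ ∈ {0.1, 0.3, 1.0} × amplitude {1, 2.5}, and the `lam = 1.5`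
  sharp bisection (no bracket: no blow-up side up to A = 1024) — finding 9, last bullet.

## Landed (importable) negative-lane modules for this crux
* `Summits/…/Theorems/PumpTransfer/Negative/RayWitnessStructure.lean` (p100192, commit 870c250fbb46): the
  `-- Targets` witness-structure facts (`volterra_zero_solution`, `rayTypeI_clause_ii_fails_at_zero`,
  `rayTypeI_clause_ii_fails_at_m_zero`) in namespace `…Theorems.PumpTransfer.Negative` — this work file keeps
  its own copies only to stay self-contained; importers should use the landed module.
* `…/Theorems/PumpTransfer/Negative/Anatomy.lean` (anatomy + load-bearing mutations over seat 1834's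
  `Theorems.CircuitPumpNegative` vocabulary): p74085/p98967 bounced on gate infrastructure ("refuter
  admissibility probe did not run"), trimmed third attempt submitted 2026-08-16 ~12:10Z (id in NOTES).
* Sibling seats' modules used here by citation: `Theorems/CircuitPump/Negative/LoadBearing.lean` (1834),
  `Theorems/AveragedTypeIBlowup/Negative/NSReduction.lean` (1835).

## Index
§1 anatomy · §2 the antecedent, named, and its small models · §3 load-bearing mutations ·
§3b the linear part cannot pump · §4 conclusion-side sanity · Targets (line `Sketch` v2: witness structure of `stub_rayTypeI`) · `-- Targets` (none yet: no skeleton/stuck stubs at cycle 1) ·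
`-- Near-misses` (none claimed).
-/

set_option linter.dupNamespace false

namespace Summit.NavierStokesRegularity.NavierStokesRegularity.Cruxes.PumpTransfer.Disproof

open Summit.NavierStokesRegularity.NavierStokesRegularity.Theses.PerpetualPump
open scoped BigOperators
open Real Set MeasureTheory Filter Topology

/-! ## §1 Logical anatomy -/

/-- `PumpTransfer` is literally `CircuitPump → AveragedTypeIBlowup` (both bodies inlined by the
planner; definitional). [folklore] -/
theorem pumpTransfer_iff : PumpTransfer ↔ (CircuitPump → AveragedTypeIBlowup) := Iff.rfl

/-- The PDE pump is the constructive negation of the route's target: `AveragedTypeIBlowup ↔ ¬ Thesis`. [folklore] -/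
theorem averagedTypeIBlowup_iff_not_thesis : AveragedTypeIBlowup ↔ ¬ Thesis := by
  unfold AveragedTypeIBlowup Thesis
  push Not
  rfl

/-- **Why this crux resists an unconditional kill**: refuting it is EQUIVALENT to building the
dyadic pump (crux #2) AND proving the route's rank-0 target `Thesis` (abstract Type-I exclusion for
every symmetric cancelling averaged Navier–Stokes equation — Tao's open footnote question). [folklore] -/
theorem not_pumpTransfer_iff : ¬ PumpTransfer ↔ (CircuitPump ∧ Thesis) := by
  rw [pumpTransfer_iff, averagedTypeIBlowup_iff_not_thesis]
  constructor
  · intro h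
    by_contra h'
    exact h fun hc hT => h' ⟨hc, hT⟩
  · rintro ⟨hc, hT⟩ h
    exact h hc hT

/-- Any refutation of the crux proves `Thesis`. [folklore] -/
theorem thesis_of_not_pumpTransfer (h : ¬ PumpTransfer) : Thesis := (not_pumpTransfer_iff.1 h).2

/-- Any refutation of the crux builds the ODE pump. [folklore] -/
theorem circuitPump_of_not_pumpTransfer (h : ¬ PumpTransfer) : CircuitPump :=
  (not_pumpTransfer_iff.1 h).1

/-- Cheap proof route 1 (vacuity): an ODE abstract-Liouville theorem closes the item without any
transfer. [folklore] -/
theorem pumpTransfer_of_not_circuitPump (h : ¬ CircuitPump) : PumpTransfer := fun hc => (h hc).elim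

/-- Cheap proof route 2 (weakening): a direct PDE pump closes the item without any transfer. [folklore] -/
theorem pumpTransfer_of_averagedTypeIBlowup (h : AveragedTypeIBlowup) : PumpTransfer := fun _ => h

/-- Contrapositive reading used by the route's bookkeeping: `PumpTransfer ∧ Thesis → ¬ CircuitPump`
(if abstract Type-I exclusion holds and transfers are automatic, no ODE pump exists). [folklore] -/
theorem not_circuitPump_of_pumpTransfer_of_thesis (h : PumpTransfer) (hT : Thesis) : ¬ CircuitPump :=
  fun hc => (averagedTypeIBlowup_iff_not_thesis.1 (h hc)) hT

/-! ## §2 The antecedent, with named conjuncts, and its small models -/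

/-- Tao's circuit right-hand side (4.3) at `α = 2/5`, exactly as inlined in the crux:
`F_{i,n}(t) = -lam^{4n/5} X_{i,n} + Σ c(i₁,i₂,i,μ) lam^{n-μ₃} X_{i₁,n-μ₃+μ₁} X_{i₂,n-μ₃+μ₂}`. [cite: Tao2016AveragedNS, (4.3)] -/
noncomputable def circuitRHS (lam : ℝ) (m : ℕ) (coeff : Fin m → Fin m → Fin m → Option (Fin 3) → ℝ)
    (X : Fin m → ℤ → ℝ → ℝ) : Fin m → ℤ → ℝ → ℝ :=
  fun (i : Fin m) (n : ℤ) (t : ℝ) => -(lam ^ ((4 / 5 : ℝ) * n)) * X i n t +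
    ∑ i₁ : Fin m, ∑ i₂ : Fin m, ∑ μ : Option (Fin 3), coeff i₁ i₂ i μ *
      lam ^ ((n : ℝ) - (if μ = some 2 then 1 else 0)) *
      X i₁ (n + ((if μ = some 0 then 1 else 0) - (if μ = some 2 then 1 else 0))) t *
      X i₂ (n + ((if μ = some 1 then 1 else 0) - (if μ = some 2 then 1 else 0))) t

/-- Tao's symmetry (4.2) of the structure constants. [cite: Tao2016AveragedNS, (4.2)] -/
def IsSymm {m : ℕ} (coeff : Fin m → Fin m → Fin m → Option (Fin 3) → ℝ) : Prop :=
  ∀ (i₁ i₂ i₃ : Fin m) (μ : Option (Fin 3)),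
    coeff i₁ i₂ i₃ μ = coeff i₂ i₁ i₃ (Option.map (Equiv.swap (0 : Fin 3) 1) μ)

/-- Cyclic (energy) cancellation of the structure constants. [cite: Tao2016AveragedNS, §4] -/
def IsCyclic {m : ℕ} (coeff : Fin m → Fin m → Fin m → Option (Fin 3) → ℝ) : Prop :=
  ∀ (v : Fin 3 → Fin m) (μ : Option (Fin 3)),
    ∑ σ : Equiv.Perm (Fin 3), coeff (v (σ 0)) (v (σ 1)) (v (σ 2)) (Option.map σ.symm μ) = 0

/-- The ODE conjunct: `X` solves the circuit system on `t < 0`. [cite: Tao2016AveragedNS, (4.3)] -/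
def SolvesODE (lam : ℝ) {m : ℕ} (coeff : Fin m → Fin m → Fin m → Option (Fin 3) → ℝ)
    (X : Fin m → ℤ → ℝ → ℝ) : Prop :=
  ∀ (i : Fin m) (n : ℤ) (t : ℝ), t < 0 → HasDerivAt (X i n) (circuitRHS lam m coeff X i n t) t

/-- The exact discrete self-similarity conjunct with period `k`. [folklore] -/
def IsDSS (lam : ℝ) {m : ℕ} (k : ℕ) (X : Fin m → ℤ → ℝ → ℝ) : Prop :=
  ∀ (i : Fin m) (n : ℤ) (t : ℝ), t < 0 →
    X i (n + k) (lam ^ (-((4 / 5 : ℝ) * k)) * t) = lam ^ (-((1 / 5 : ℝ) * k)) * X i n t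

/-- The Type-I (sup-in-scale, `L^∞`-weight `lam^{3n/5} = N_n^{3/2}`) conjunct. [cite: KochNadirashviliSereginSverak2009, (1.4)] -/
def IsTypeI (lam : ℝ) {m : ℕ} (X : Fin m → ℤ → ℝ → ℝ) : Prop :=
  ∃ C : ℝ, ∀ (i : Fin m) (n : ℤ) (t : ℝ), t < 0 → lam ^ ((3 / 5 : ℝ) * n) * |X i n t| ≤ C / Real.sqrt (-t)

/-- Non-triviality conjunct. [folklore] -/
def IsNontrivial {m : ℕ} (X : Fin m → ℤ → ℝ → ℝ) : Prop :=
  ∃ (i : Fin m) (n : ℤ) (t : ℝ), t < 0 ∧ X i n t ≠ 0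

/-- A pump witness at scale ratio `lam`: the body of `CircuitPump` after `∃ lam`. [folklore] -/
def PumpWitness (lam : ℝ) (m : ℕ) (coeff : Fin m → Fin m → Fin m → Option (Fin 3) → ℝ) (k : ℕ)
    (X : Fin m → ℤ → ℝ → ℝ) : Prop :=
  IsSymm coeff ∧ IsCyclic coeff ∧ 1 ≤ k ∧ SolvesODE lam coeff X ∧ IsDSS lam k X ∧ IsTypeI lam X ∧
    IsNontrivial X

/-- `CircuitPump` restated through the named conjuncts (definitional). [folklore] -/
theorem circuitPump_iff :
    CircuitPump ↔ ∀ lam₀ : ℝ, 1 < lam₀ → ∃ lam : ℝ, 1 < lam ∧ lam < lam₀ ∧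
      ∃ (m : ℕ) (coeff : Fin m → Fin m → Fin m → Option (Fin 3) → ℝ) (k : ℕ) (X : Fin m → ℤ → ℝ → ℝ),
        PumpWitness lam m coeff k X :=
  Iff.rfl

/-- The antecedent of `PumpTransfer` is `CircuitPump` verbatim (definitional), so the crux composes
with stmt-1834/1835 by name. [folklore] -/
theorem pumpTransfer_iff' :
    PumpTransfer ↔ ((∀ lam₀ : ℝ, 1 < lam₀ → ∃ lam : ℝ, 1 < lam ∧ lam < lam₀ ∧
      ∃ (m : ℕ) (coeff : Fin m → Fin m → Fin m → Option (Fin 3) → ℝ) (k : ℕ) (X : Fin m → ℤ → ℝ → ℝ),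
        PumpWitness lam m coeff k X) → AveragedTypeIBlowup) :=
  Iff.rfl

/-- **Small model `m = 0`**: no modes, no pump (non-triviality needs an inhabitant of `Fin 0`). [folklore] -/
theorem no_witness_m0 (lam : ℝ) (coeff : Fin 0 → Fin 0 → Fin 0 → Option (Fin 3) → ℝ) (k : ℕ)
    (X : Fin 0 → ℤ → ℝ → ℝ) : ¬ PumpWitness lam 0 coeff k X := by
  rintro ⟨-, -, -, -, -, -, i, -⟩
  exact i.elim0

/-- **Small model `m = 1`**: symmetry (4.2) and cyclic cancellation leave a ONE-parameter family,
`c none = 0`, `c (some 0) = c (some 1) = a`, `c (some 2) = -2a` — the Katz–Pavlović/Cheskidov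
dyadic model `Ẋ_n = -lam^{4n/5}X_n + 2a(lam^n X_n X_{n+1} - lam^{n-1} X_{n-1}²)` at intermittency
`α = 2/5`. [folklore] -/
theorem m1_coeff_classification (coeff : Fin 1 → Fin 1 → Fin 1 → Option (Fin 3) → ℝ)
    (hs : IsSymm coeff) (hc : IsCyclic coeff) :
    coeff 0 0 0 none = 0 ∧ coeff 0 0 0 (some 1) = coeff 0 0 0 (some 0) ∧
      coeff 0 0 0 (some 2) = -2 * coeff 0 0 0 (some 0) := by
  -- reduce to the single function g = coeff 0 0 0
  set g : Option (Fin 3) → ℝ := coeff 0 0 0 with hg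
  have hv : ∀ (v : Fin 3 → Fin 1) (a b c : Fin 3), coeff (v a) (v b) (v c) = g := by
    intro v a b c
    rw [hg, Fin.fin_one_eq_zero (v a), Fin.fin_one_eq_zero (v b), Fin.fin_one_eq_zero (v c)]
  have hc' : ∀ μ : Option (Fin 3), ∑ σ : Equiv.Perm (Fin 3), g (Option.map σ.symm μ) = 0 := by
    intro μ
    have := hc (fun _ => 0) μ
    simpa [hv] using this
  have hcard : (Finset.univ : Finset (Equiv.Perm (Fin 3))).card = 6 := by
    rw [Finset.card_univ, Fintype.card_perm, Fintype.card_fin]; rfl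
  -- μ = none : 6 • g none = 0
  have h0 : g none = 0 := by
    have h := hc' none
    simp only [Option.map_none, Finset.sum_const, hcard, nsmul_eq_mul] at h
    push_cast at h
    linarith
  -- some : sum over j of the cyclic sums = 6 • (g (some 0) + g (some 1) + g (some 2))
  have hsum : g (some 0) + g (some 1) + g (some 2) = 0 := by
    have h1 : ∑ j : Fin 3, ∑ σ : Equiv.Perm (Fin 3), g (some (σ.symm j)) = 0 := by
      refine Finset.sum_eq_zero (fun j _ => ?_)
      have := hc' (some j)
      simpa using this
    rw [Finset.sum_comm] at h1
    have h2 : ∀ σ : Equiv.Perm (Fin 3),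
        ∑ j : Fin 3, g (some (σ.symm j)) = ∑ j : Fin 3, g (some j) :=
      fun σ => Equiv.sum_comp σ.symm (fun j => g (some j))
    simp only [h2, Finset.sum_const, hcard, nsmul_eq_mul, Fin.sum_univ_three] at h1
    push_cast at h1
    linarith
  have h01 : g (some 0) = g (some 1) := by
    have := hs 0 0 0 (some 0)
    simpa [hg] using this
  refine ⟨h0, h01.symm, ?_⟩
  linarith

/-! ## §3 Load-bearing mutations of the antecedent

Dropping a conjunct `H` of the inlined `CircuitPump` gives `PumpTransferWithout<H> :=
AntecedentWithout<H> → AveragedTypeIBlowup`. Whenever `AntecedentWithout<H>` is provable outright,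
the mutated crux is literally `¬ Thesis`. This happens for `H ∈ {ODE, TypeI, Nontrivial}` with
closed-form witnesses; it is NOT known to happen for `H ∈ {DSS, Symm+Cyclic}` (energy monotonicity
`Ė = -Σ lam^{4n/5} X² ≤ 0` forward in time kills every finite-dimensional or scale-decoupled
ancient candidate against the Type-I decay `X → 0` as `t → -∞`; a witness there is again a genuine
ancient critical object). -/

/-- Antecedent with the ODE conjunct dropped. [folklore] -/
def AntecedentWithoutODE : Prop :=
  ∀ lam₀ : ℝ, 1 < lam₀ → ∃ lam : ℝ, 1 < lam ∧ lam < lam₀ ∧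
    ∃ (m : ℕ) (coeff : Fin m → Fin m → Fin m → Option (Fin 3) → ℝ) (k : ℕ) (X : Fin m → ℤ → ℝ → ℝ),
      IsSymm coeff ∧ IsCyclic coeff ∧ 1 ≤ k ∧ IsDSS lam k X ∧ IsTypeI lam X ∧ IsNontrivial X

/-- Antecedent with the Type-I conjunct dropped. [folklore] -/
def AntecedentWithoutTypeI : Prop :=
  ∀ lam₀ : ℝ, 1 < lam₀ → ∃ lam : ℝ, 1 < lam ∧ lam < lam₀ ∧
    ∃ (m : ℕ) (coeff : Fin m → Fin m → Fin m → Option (Fin 3) → ℝ) (k : ℕ) (X : Fin m → ℤ → ℝ → ℝ),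
      IsSymm coeff ∧ IsCyclic coeff ∧ 1 ≤ k ∧ SolvesODE lam coeff X ∧ IsDSS lam k X ∧ IsNontrivial X

/-- Antecedent with non-triviality dropped. [folklore] -/
def AntecedentWithoutNontrivial : Prop :=
  ∀ lam₀ : ℝ, 1 < lam₀ → ∃ lam : ℝ, 1 < lam ∧ lam < lam₀ ∧
    ∃ (m : ℕ) (coeff : Fin m → Fin m → Fin m → Option (Fin 3) → ℝ) (k : ℕ) (X : Fin m → ℤ → ℝ → ℝ),
      IsSymm coeff ∧ IsCyclic coeff ∧ 1 ≤ k ∧ SolvesODE lam coeff X ∧ IsDSS lam k X ∧ IsTypeI lam X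

/-- The zero structure constants are symmetric. [folklore] -/
theorem isSymm_zero (m : ℕ) : IsSymm (fun (_ _ _ : Fin m) (_ : Option (Fin 3)) => (0 : ℝ)) :=
  fun _ _ _ _ => rfl

/-- The zero structure constants are cyclic-cancelling. [folklore] -/
theorem isCyclic_zero (m : ℕ) : IsCyclic (fun (_ _ _ : Fin m) (_ : Option (Fin 3)) => (0 : ℝ)) :=
  fun _ _ => by simp

/-- With zero structure constants the circuit is the decoupled heat flow `F = -lam^{4n/5} X`. [folklore] -/
theorem circuitRHS_zero_coeff (lam : ℝ) (m : ℕ) (X : Fin m → ℤ → ℝ → ℝ) (i : Fin m) (n : ℤ) (t : ℝ) :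
    circuitRHS lam m (fun _ _ _ _ => 0) X i n t = -(lam ^ ((4 / 5 : ℝ) * n)) * X i n t := by
  simp [circuitRHS]

/-- A scale ratio strictly between `1` and `lam₀`. [folklore] -/
theorem exists_lam (lam₀ : ℝ) (h : 1 < lam₀) : ∃ lam : ℝ, 1 < lam ∧ lam < lam₀ :=
  ⟨(1 + lam₀) / 2, by linarith, by linarith⟩

/-- Scaling identity behind the DSS property of `X_n(t) = lam^{-3n/5}/√(-t)`. [folklore] -/
theorem dss_identity_sqrt (lam : ℝ) (hlam : 0 < lam) (a t : ℝ) :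
    lam ^ (-((3 / 5 : ℝ) * (a + 1))) / Real.sqrt (-(lam ^ (-(4 / 5 : ℝ)) * t)) =
      lam ^ (-(1 / 5 : ℝ)) * (lam ^ (-((3 / 5 : ℝ) * a)) / Real.sqrt (-t)) := by
  have h4 : -(lam ^ (-(4 / 5 : ℝ)) * t) = lam ^ (-(4 / 5 : ℝ)) * (-t) := by ring
  have hs : Real.sqrt (lam ^ (-(4 / 5 : ℝ)) * (-t)) = lam ^ (-(2 / 5 : ℝ)) * Real.sqrt (-t) := by
    rw [Real.sqrt_mul (le_of_lt (Real.rpow_pos_of_pos hlam _)), Real.sqrt_eq_rpow,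
      ← Real.rpow_mul (le_of_lt hlam)]
    norm_num
  have hA : lam ^ (-((3 / 5 : ℝ) * (a + 1))) =
      lam ^ (-(1 / 5 : ℝ)) * lam ^ (-(2 / 5 : ℝ)) * lam ^ (-((3 / 5 : ℝ) * a)) := by
    rw [← Real.rpow_add hlam, ← Real.rpow_add hlam]
    congr 1
    ring
  have hpos : (lam ^ (-(2 / 5 : ℝ))) ≠ 0 := (Real.rpow_pos_of_pos hlam _).ne'
  rw [h4, hs, hA]
  rcases eq_or_ne (Real.sqrt (-t)) 0 with h0 | h0
  · simp [h0]
  · field_simp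

/-- **Dropping the ODE trivialises the antecedent**: `X_n(t) = lam^{-3n/5}/√(-t)` (one mode,
zero constants, period 1) is DSS, exactly Type-I (`C = 1`) and non-trivial. [folklore] -/
theorem antecedentWithoutODE_holds : AntecedentWithoutODE := by
  intro lam₀ hlam₀
  obtain ⟨lam, h1, h2⟩ := exists_lam lam₀ hlam₀
  have hlam : 0 < lam := by linarith
  refine ⟨lam, h1, h2, 1, fun _ _ _ _ => 0, 1,
    fun _ n t => lam ^ (-((3 / 5 : ℝ) * n)) / Real.sqrt (-t), isSymm_zero 1, isCyclic_zero 1,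
    le_rfl, ?_, ?_, ?_⟩
  · -- DSS
    intro i n t _
    have key := dss_identity_sqrt lam hlam (n : ℝ) t
    push_cast
    simp only [mul_one]
    exact key
  · -- Type I with C = 1
    refine ⟨1, fun i n t ht => ?_⟩
    have hpos : 0 < lam ^ ((3 / 5 : ℝ) * n) := Real.rpow_pos_of_pos hlam _
    have hsqrt : 0 < Real.sqrt (-t) := Real.sqrt_pos.2 (by linarith)
    dsimp only
    rw [abs_of_pos (div_pos (Real.rpow_pos_of_pos hlam _) hsqrt), Real.rpow_neg (le_of_lt hlam),
      ← mul_div_assoc, mul_inv_cancel₀ hpos.ne']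
  · -- non-trivial at (i,n,t) = (0,0,-1)
    refine ⟨0, 0, -1, by norm_num, ?_⟩
    simp [Real.rpow_zero]

/-- Scaling identity behind the DSS property of the free heat modes. [folklore] -/
theorem dss_identity_exp (lam : ℝ) (hlam : 0 < lam) (a t : ℝ) :
    lam ^ (-((1 / 5 : ℝ) * (a + 1))) * Real.exp (-(lam ^ ((4 / 5 : ℝ) * (a + 1))) * (lam ^ (-(4 / 5 : ℝ)) * t)) =
      lam ^ (-(1 / 5 : ℝ)) * (lam ^ (-((1 / 5 : ℝ) * a)) * Real.exp (-(lam ^ ((4 / 5 : ℝ) * a)) * t)) := by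
  have hE : lam ^ ((4 / 5 : ℝ) * (a + 1)) * lam ^ (-(4 / 5 : ℝ)) = lam ^ ((4 / 5 : ℝ) * a) := by
    rw [← Real.rpow_add hlam]
    congr 1
    ring
  have hA : lam ^ (-((1 / 5 : ℝ) * (a + 1))) = lam ^ (-(1 / 5 : ℝ)) * lam ^ (-((1 / 5 : ℝ) * a)) := by
    rw [← Real.rpow_add hlam]
    congr 1
    ring
  rw [hA, show -(lam ^ ((4 / 5 : ℝ) * (a + 1))) * (lam ^ (-(4 / 5 : ℝ)) * t) =
      -(lam ^ ((4 / 5 : ℝ) * (a + 1)) * lam ^ (-(4 / 5 : ℝ))) * t by ring, hE]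
  ring

/-- **Dropping the Type-I bound trivialises the antecedent**: the free heat modes
`X_n(t) = lam^{-n/5} exp(-lam^{4n/5} t)` (`m = 1`, zero constants, period `1`) solve the circuit,
are exactly DSS and non-trivial — and violate Type I as `t → -∞`, which is the only thing that
keeps `PumpTransfer` from being `¬ Thesis` outright. [folklore] -/
theorem antecedentWithoutTypeI_holds : AntecedentWithoutTypeI := by
  intro lam₀ hlam₀
  obtain ⟨lam, h1, h2⟩ := exists_lam lam₀ hlam₀
  have hlam : 0 < lam := by linarith
  refine ⟨lam, h1, h2, 1, fun _ _ _ _ => 0, 1,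
    fun _ n t => lam ^ (-((1 / 5 : ℝ) * n)) * Real.exp (-(lam ^ ((4 / 5 : ℝ) * n)) * t),
    isSymm_zero 1, isCyclic_zero 1, le_rfl, ?_, ?_, ?_⟩
  · -- ODE: d/dt [a e^{-d t}] = -d (a e^{-d t})
    intro i n t _
    rw [circuitRHS_zero_coeff]
    have h := ((hasDerivAt_id t).const_mul (-(lam ^ ((4 / 5 : ℝ) * n)))).exp.const_mul
      (lam ^ (-((1 / 5 : ℝ) * n)))
    refine h.congr_deriv ?_
    simp only [id]
    ring
  · -- DSS
    intro i n t _
    have key := dss_identity_exp lam hlam (n : ℝ) t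
    push_cast
    simp only [mul_one]
    exact key
  · refine ⟨0, 0, -1, by norm_num, ?_⟩
    simp [Real.rpow_zero, Real.exp_ne_zero]

/-- **Dropping non-triviality trivialises the antecedent**: `X = 0`. [folklore] -/
theorem antecedentWithoutNontrivial_holds : AntecedentWithoutNontrivial := by
  intro lam₀ hlam₀
  obtain ⟨lam, h1, h2⟩ := exists_lam lam₀ hlam₀
  refine ⟨lam, h1, h2, 1, fun _ _ _ _ => 0, 1, fun _ _ _ => 0, isSymm_zero 1, isCyclic_zero 1,
    le_rfl, ?_, ?_, ?_⟩
  · intro i n t _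
    rw [circuitRHS_zero_coeff, mul_zero]
    exact hasDerivAt_const t 0
  · intro i n t _
    simp
  · exact ⟨0, fun i n t _ => by simp⟩

/-- Mutated crux without the ODE is literally `¬ Thesis`. [folklore] -/
theorem pumpTransferWithoutODE_iff_not_thesis :
    (AntecedentWithoutODE → AveragedTypeIBlowup) ↔ ¬ Thesis := by
  rw [← averagedTypeIBlowup_iff_not_thesis]
  exact ⟨fun h => h antecedentWithoutODE_holds, fun h _ => h⟩

/-- Mutated crux without Type I is literally `¬ Thesis`. [folklore] -/
theorem pumpTransferWithoutTypeI_iff_not_thesis :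
    (AntecedentWithoutTypeI → AveragedTypeIBlowup) ↔ ¬ Thesis := by
  rw [← averagedTypeIBlowup_iff_not_thesis]
  exact ⟨fun h => h antecedentWithoutTypeI_holds, fun h _ => h⟩

/-- Mutated crux without non-triviality is literally `¬ Thesis`. [folklore] -/
theorem pumpTransferWithoutNontrivial_iff_not_thesis :
    (AntecedentWithoutNontrivial → AveragedTypeIBlowup) ↔ ¬ Thesis := by
  rw [← averagedTypeIBlowup_iff_not_thesis]
  exact ⟨fun h => h antecedentWithoutNontrivial_holds, fun h _ => h⟩

/-! ## §3b The linear part of the class cannot pump (Type I ∧ ODE bite together) -/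

/-- **Free-mode lemma**: a solution of `X' = -d X` on `t < 0` (`d > 0`) obeying a Type-I bound
`w |X t| ≤ C/√(-t)` (`w > 0`) vanishes identically — backward growth `e^{-dt}` against decay
`(-t)^{-1/2}` as `t → -∞` (constancy of `e^{dt} X t` via `constant_of_has_deriv_right_zero`). [folklore] -/
theorem free_mode_vanishes (d w C : ℝ) (hd : 0 < d) (hw : 0 < w) (X : ℝ → ℝ)
    (hode : ∀ t : ℝ, t < 0 → HasDerivAt X (-d * X t) t)
    (hC : ∀ t : ℝ, t < 0 → w * |X t| ≤ C / Real.sqrt (-t)) :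
    ∀ t : ℝ, t < 0 → X t = 0 := by
  intro t₀ ht₀
  by_contra hX
  -- g = exp(d t) X t has zero derivative on t < 0
  set g : ℝ → ℝ := fun t => Real.exp (d * t) * X t with hg
  have hgd : ∀ t : ℝ, t < 0 → HasDerivAt g 0 t := by
    intro t ht
    have h1 : HasDerivAt (fun x => Real.exp (d * x)) (Real.exp (d * t) * d) t := by
      have := ((hasDerivAt_id t).const_mul d).exp
      simpa using this
    have h2 := h1.mul (hode t ht)
    refine h2.congr_deriv ?_
    ring
  -- constancy on [s, t₀] for s ≤ t₀
  have hconst : ∀ s : ℝ, s ≤ t₀ → g t₀ = g s := by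
    intro s hs
    have hcont : ContinuousOn g (Icc s t₀) := fun x hx =>
      (hgd x (lt_of_le_of_lt hx.2 ht₀)).continuousAt.continuousWithinAt
    have hder : ∀ x ∈ Ico s t₀, HasDerivWithinAt g 0 (Ici x) x := fun x hx =>
      (hgd x (lt_trans hx.2 ht₀)).hasDerivWithinAt
    exact constant_of_has_deriv_right_zero hcont hder t₀ ⟨hs, le_rfl⟩
  -- positivity of C
  have hsq0 : 0 < Real.sqrt (-t₀) := Real.sqrt_pos.2 (by linarith)
  have hXpos : 0 < |X t₀| := abs_pos.2 hX
  have hCpos : 0 < C := by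
    have h := hC t₀ ht₀
    have : 0 < C / Real.sqrt (-t₀) := lt_of_lt_of_le (mul_pos hw hXpos) h
    exact (div_pos_iff_of_pos_right hsq0).1 this
  -- the limit exp(d s) → 0 as s → -∞
  set L : ℝ := w * (Real.exp (d * t₀) * |X t₀|) * Real.sqrt (-t₀) / C with hL
  have hLpos : 0 < L := by
    rw [hL]; positivity
  have hlim : Tendsto (fun s : ℝ => Real.exp (d * s)) atBot (𝓝 0) :=
    Real.tendsto_exp_atBot.comp (Filter.Tendsto.const_mul_atBot hd tendsto_id)
  obtain ⟨s, hs1, hs2⟩ := ((hlim.eventually (gt_mem_nhds hLpos)).and (eventually_lt_atBot t₀)).exists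
  have hs0 : s < 0 := lt_trans hs2 ht₀
  have hsqs : 0 < Real.sqrt (-s) := Real.sqrt_pos.2 (by linarith)
  have hsq_le : Real.sqrt (-t₀) ≤ Real.sqrt (-s) := Real.sqrt_le_sqrt (by linarith)
  -- Type-I at s
  have h1 : w * |X s| * Real.sqrt (-s) ≤ C := (le_div_iff₀ hsqs).1 (hC s hs0)
  have h2 : w * |X s| * Real.sqrt (-t₀) ≤ C := by
    calc w * |X s| * Real.sqrt (-t₀) ≤ w * |X s| * Real.sqrt (-s) := by
          gcongr
      _ ≤ C := h1
  -- transport along the constancy: exp(d s) X s = exp(d t₀) X t₀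
  have h3 : Real.exp (d * s) * X s = Real.exp (d * t₀) * X t₀ := (hconst s hs2.le).symm
  have h4 : Real.exp (d * s) * |X s| = Real.exp (d * t₀) * |X t₀| := by
    have := congrArg abs h3
    rwa [abs_mul, abs_mul, abs_of_pos (Real.exp_pos _), abs_of_pos (Real.exp_pos _)] at this
  have hexp : 0 < Real.exp (d * s) := Real.exp_pos _
  -- multiply h2 by exp(d s)
  have h5 : w * (Real.exp (d * t₀) * |X t₀|) * Real.sqrt (-t₀) ≤ C * Real.exp (d * s) := by
    have := mul_le_mul_of_nonneg_left h2 hexp.le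
    calc w * (Real.exp (d * t₀) * |X t₀|) * Real.sqrt (-t₀)
        = Real.exp (d * s) * (w * |X s| * Real.sqrt (-t₀)) := by rw [← h4]; ring
      _ ≤ Real.exp (d * s) * C := this
      _ = C * Real.exp (d * s) := by ring
  -- but exp(d s) < L = lhs / C
  have h6 : C * Real.exp (d * s) < C * L := mul_lt_mul_of_pos_left hs1 hCpos
  have h7 : C * L = w * (Real.exp (d * t₀) * |X t₀|) * Real.sqrt (-t₀) := by
    rw [hL]; field_simp
  linarith

/-- **The linear part of the class cannot pump**: with zero structure constants every pump witness
is trivial, for every scale ratio `lam > 0`, every `m` and every period `k` — the ODE and Type-I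
conjuncts genuinely bite together (the witness of `antecedentWithoutTypeI_holds` is exactly the
free heat modes excluded here). Any `CircuitPump` witness therefore has `coeff ≠ 0`. [folklore] -/
theorem no_witness_zero_coeff (lam : ℝ) (hlam : 0 < lam) (m k : ℕ) (X : Fin m → ℤ → ℝ → ℝ) :
    ¬ PumpWitness lam m (fun _ _ _ _ => 0) k X := by
  rintro ⟨-, -, -, hode, -, ⟨C, hC⟩, ⟨i, n, t₀, ht₀, hX⟩⟩
  have hd : 0 < lam ^ ((4 / 5 : ℝ) * n) := Real.rpow_pos_of_pos hlam _
  have hw : 0 < lam ^ ((3 / 5 : ℝ) * n) := Real.rpow_pos_of_pos hlam _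
  have hode' : ∀ t : ℝ, t < 0 → HasDerivAt (X i n) (-(lam ^ ((4 / 5 : ℝ) * n)) * X i n t) t := by
    intro t ht
    have := hode i n t ht
    rwa [circuitRHS_zero_coeff] at this
  exact hX (free_mode_vanishes _ _ C hd hw (X i n) hode' (fun t ht => hC i n t ht) t₀ ht₀)

/-- Corollary in the shape the provers of crux #2 consume: every `CircuitPump`-type witness has a
non-zero structure constant. [folklore] -/
theorem coeff_ne_zero_of_witness {lam : ℝ} (hlam : 0 < lam) {m k : ℕ}
    {coeff : Fin m → Fin m → Fin m → Option (Fin 3) → ℝ} {X : Fin m → ℤ → ℝ → ℝ}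
    (h : PumpWitness lam m coeff k X) : coeff ≠ fun _ _ _ _ => 0 := by
  rintro rfl
  exact no_witness_zero_coeff lam hlam m k X h

/-! ## §4 Conclusion-side sanity: the zero solution never witnesses the PDE pump -/

/-- `u ≡ 0` with datum `0` is a mild solution on every `Ico 0 T'`; in particular a would-be witness of
`AveragedTypeIBlowup` with `u = 0` on `[0,T)` and `schwartzL2 u₀ = 0` always extends (take
`T' = T + 1`, `v = 0`). So the conclusion is not junk-true through the trivial solution. [folklore] -/
theorem zero_solution_extends (𝒜 : Literature.Analysis.FluidPDE.Tao2016.AveragingDatum) (T : ℝ)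
    (u : ℝ → Literature.Analysis.FluidPDE.Tao2016.L2C) (hu : ∀ t ∈ Set.Ico 0 T, u t = 0) :
    ∃ T' : ℝ, T < T' ∧ ∃ v : ℝ → Literature.Analysis.FluidPDE.Tao2016.L2C,
      𝒜.IsMildSolution 0 (Set.Ico 0 T') v ∧ ∀ t ∈ Set.Ico 0 T, v t = u t :=
  ⟨T + 1, by linarith, fun _ => 0, 𝒜.isMildSolution_zero _, fun t ht => (hu t ht).symm⟩

-- Targets
/-! ## Targets — line `Sketch` (lead prover-line-stmt-NavierStokesRegularity-1837-0), skeleton v2 (2026-08-16T08:46Z)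

Registered stubs (workitem `skeleton.stubs`): `stub_volterra_maximal` (U uniqueness + M maximality of the
lifted Volterra system on a ray; lead, with sub-goal `stub_volterra_local` = Picard step with history),
`stub_rayTypeI` (RESEARCH: some cascade circuit — any `m`, wavelet data `𝒟` with the free ball-radius dial,
symmetric cancelling `α` — and a RAY datum `A•ψ_{i₀,n₀}` whose lifted Volterra solution (i) exists up to `T*`,
(ii) has no `H¹⁰`-weight-bounded continuation on any `[0,S)`, `S > T*`, (iii) obeys the Type-I fibre-sum bound
`Σ_p (1+ε₀)^{3n/2} B_p(t) ≤ M/√(T*−t)` for every solution before `T*`), and the four SYNTHESIS stubs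
`stub_bandField_exists`, `stub_mild_of_bandField`, `stub_modeCoeff_of_bandField`, `stub_linfty_of_bandField`
(all four LANDED by the lead: p90630, p92037, p87248, p88941; helpers p90115, p90118). No `stuck_stubs` posted.

ATTACK LOG (cycle 1, this seat):
* Logical position: the line proves the CONSEQUENT (`AveragedTypeIBlowup`, via `not_thesis_of_cascade` +
  Thm 3.2) and closes the crux by weakening — cheap route 2 of §1; it never touches the anonymous
  `CircuitPump` witness. Consistent with findings 2/7/8; not an objection.
* `stub_rayTypeI` — no kill (it is the threshold-classification claim (R) of finding 8 (ii) in Volterra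
  clothes; refuting it for ALL circuits is an abstract Liouville theorem). Signature checks PASSED:
  (a) the solution class asks `Continuous (X i n)` on all of `ℝ` with the equation only on `Ico 0 S` — harmless
  in (i) (for `S < T*` restrict a solution living slightly longer) and exactly right in (ii) (a blow-up of the
  `H¹⁰` weight at `T* < S` violates the bound clause at `S' = T*`; the weight `(1+ε₀)^{10n}` does diverge on a
  geometric residual trail, so (ii) is not defeated by trail freezing); (b) clause (iii) at `S = T*` is
  typically VACUOUS (a solution on `[0,T*)` that blows up has no continuous extension to `ℝ`), the content is
  `S < T*` — fine; (c) (iii) near `t = 0` only costs `M ≥ (1+ε₀)^{3n₀/2}|A|√T*`; (d) `B_p` is demanded only on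
  `supp modeWeight` ✓; (e) no uniform-in-`ε₀` constant is asked (rightly: for Tao-type gates `M ≳ A* ~ 1/ε₀`,
  but structure constants are unnormalised, so no uniform strengthening is even meaningful).
  STRUCTURE OF ANY WITNESS (proved below, cheap): `A ≠ 0` (`rayTypeI_clause_ii_fails_at_zero`: at `A = 0` the
  zero field is a global bounded Volterra solution, contradicting (ii)) and `m ≥ 1`
  (`rayTypeI_clause_ii_fails_at_m_zero`: `Fin 0` is empty, the empty field solves everything).
* `stub_volterra_maximal` — looks TRUE (standard Volterra well-posedness with the `H¹⁰` weight as the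
  continuation norm; (M)'s blow-up weight `(1+((1+ε₀)^n)^2)^5 = (1+N_n²)^5` vs the bound weight
  `1+N_n^{10}` differ by a bounded factor ✓ consistent). Not attacked further.
* JOINT SUFFICIENCY: `PumpTransfer_of` is kernel-checked by the skeleton gate; semantically the composition
  (rayTypeI ⟹ band field ⟹ mild solution + `L^∞` rate + no extension ⟹ cascade-level `¬Thesis` ⟹
  `AveragedTypeIBlowup`) uses (U) to identify "every Volterra solution" with "the" solution and the `H¹⁰`
  lower bound `enorm_pairing_cascadeWavelet_le` for non-extension — no smuggled gap visible from the stub list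
  (the skeleton file itself lives in the lead's folder and is not published under `Lines/`; request: publish it).
-/

section Targets
open Literature.Analysis.FluidPDE Literature.Analysis.FluidPDE.Tao2016

variable {ε₀ : ℝ} {m : ℕ}

/-- The circuit nonlinearity vanishes on the zero coefficient field. [folklore] -/
theorem quadTerm_zero (α : Fin m → Fin m → Fin m → ℤ × ℤ × ℤ → ℝ) (i : Fin m) (n : ℤ) (t : ℝ) :
    TaoCascade.quadTerm ε₀ α (fun (_ : Fin m) (_ : ℤ) (_ : ℝ) => (0 : ℝ)) i n t = 0 := by
  simp [TaoCascade.quadTerm]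

/-- The heat fibre with zero datum and zero forcing vanishes. [folklore] -/
theorem duhamelScalar_zero_zero (L t : ℝ) : duhamelScalar 0 (fun _ : ℝ => (0 : ℝ)) L t = 0 := by
  simp [duhamelScalar]

/-- **`X ≡ 0` solves the lifted Volterra system of the ray datum `A • ψ_{i₀,n₀}` when `A = 0`**, on
every time set, with every weighted bound. [folklore] -/
theorem volterra_zero_solution (𝒟 : CascadeWaveletData ε₀ m)
    (α : Fin m → Fin m → Fin m → ℤ × ℤ × ℤ → ℝ) (i₀ : Fin m) (n₀ : ℤ) (i : Fin m) (n : ℤ) (t : ℝ) :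
    (fun (_ : Fin m) (_ : ℤ) (_ : ℝ) => (0 : ℝ)) i n t =
      ∫ ξ : EuclideanSpace ℝ (Fin 3), duhamelScalar ((0 : ℝ) * modeDelta i₀ i n₀ n)
        (fun s => TaoCascade.quadTerm ε₀ α (fun (_ : Fin m) (_ : ℤ) (_ : ℝ) => (0 : ℝ)) i n (max s 0))
        (heatRate ξ) t * modeWeight 𝒟 i n ξ := by
  simp only [zero_mul]
  have h : ∀ ξ : EuclideanSpace ℝ (Fin 3), duhamelScalar 0
      (fun s => TaoCascade.quadTerm ε₀ α (fun (_ : Fin m) (_ : ℤ) (_ : ℝ) => (0 : ℝ)) i n (max s 0))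
      (heatRate ξ) t = 0 := by
    intro ξ
    have : (fun s => TaoCascade.quadTerm ε₀ α (fun (_ : Fin m) (_ : ℤ) (_ : ℝ) => (0 : ℝ)) i n (max s 0))
        = fun _ : ℝ => (0 : ℝ) := by
      funext s; exact quadTerm_zero α i n (max s 0)
    rw [this, duhamelScalar_zero_zero]
  simp [h]

/-- **Any witness of `stub_rayTypeI` has `A ≠ 0`**: for `A = 0` the non-extension clause (ii) fails on
every `[0,S)` — the zero field is a continuous, `H¹⁰`-weight-bounded Volterra solution there. Stated as
the negation of clause (ii) at `A = 0` for arbitrary data. [folklore] -/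
theorem rayTypeI_clause_ii_fails_at_zero (𝒟 : CascadeWaveletData ε₀ m)
    (α : Fin m → Fin m → Fin m → ℤ × ℤ × ℤ → ℝ) (i₀ : Fin m) (n₀ : ℤ) (S : ℝ) :
    ∃ X : Fin m → ℤ → ℝ → ℝ, (∀ (i : Fin m) (n : ℤ), Continuous (X i n)) ∧
      (∀ (i : Fin m) (n : ℤ), ∀ t ∈ Ico (0 : ℝ) S, X i n t =
        ∫ ξ : EuclideanSpace ℝ (Fin 3), duhamelScalar ((0 : ℝ) * modeDelta i₀ i n₀ n)
          (fun s => TaoCascade.quadTerm ε₀ α X i n (max s 0)) (heatRate ξ) t * modeWeight 𝒟 i n ξ) ∧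
      (∀ S' ∈ Ico (0 : ℝ) S, ∃ C : ℝ, ∀ (i : Fin m) (n : ℤ), ∀ t ∈ Icc (0 : ℝ) S',
        (1 + ((1 + ε₀) ^ n) ^ 10) * |X i n t| ≤ C) :=
  ⟨fun _ _ _ => 0, fun _ _ => continuous_const,
    fun i n t _ => volterra_zero_solution 𝒟 α i₀ n₀ i n t,
    fun _ _ => ⟨0, fun i n t _ => by simp⟩⟩

/-- **Any witness of `stub_rayTypeI` has `m ≥ 1`**: for `m = 0` the mode type `Fin 0` is empty, the
(unique, empty) coefficient field solves everything vacuously on every `[0,S)`, so clause (ii) fails.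
[folklore] -/
theorem rayTypeI_clause_ii_fails_at_m_zero {ε₀ : ℝ} (𝒟 : CascadeWaveletData ε₀ 0)
    (α : Fin 0 → Fin 0 → Fin 0 → ℤ × ℤ × ℤ → ℝ) (i₀ : Fin 0) (n₀ : ℤ) (A S : ℝ) :
    ∃ X : Fin 0 → ℤ → ℝ → ℝ, (∀ (i : Fin 0) (n : ℤ), Continuous (X i n)) ∧
      (∀ (i : Fin 0) (n : ℤ), ∀ t ∈ Ico (0 : ℝ) S, X i n t =
        ∫ ξ : EuclideanSpace ℝ (Fin 3), duhamelScalar (A * modeDelta i₀ i n₀ n)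
          (fun s => TaoCascade.quadTerm ε₀ α X i n (max s 0)) (heatRate ξ) t * modeWeight 𝒟 i n ξ) ∧
      (∀ S' ∈ Ico (0 : ℝ) S, ∃ C : ℝ, ∀ (i : Fin 0) (n : ℤ), ∀ t ∈ Icc (0 : ℝ) S',
        (1 + ((1 + ε₀) ^ n) ^ 10) * |X i n t| ≤ C) :=
  i₀.elim0

end Targets

-- Near-misses
/-! ## Near-misses: none claimed. The only route to `¬ PumpTransfer` is `CircuitPump ∧ Thesis`
(`not_pumpTransfer_iff`); neither conjunct is a near-miss. -/

end Summit.NavierStokesRegularity.NavierStokesRegularity.Cruxes.PumpTransfer.Disproof
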